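import Literature.NumberTheory.EllipticCurves.Kato2004.DivisibilityInputsContragredient
import HarnessLib

/-!
# Kato 2004 (Astérisque 295), Thm. 17.4 (1) «`X` is a torsion `Λ`-module» at the level of the §17.13 ∃-packages at a
# MULTIPLICATIVE prime: `MultDivisibilityInputs.isTorsion_X` / `MultDivisibilityInputsContra.isTorsion_X` — PROVED module
# theory (theorems only)

K. Kato, *`p`-adic Hodge theory and values of zeta functions of modular forms*, Astérisque **295** (2004)
[Kato2004Asterisque], Thm. 17.4 (1) (p. 273): «`𝔛(T) = H¹(ℤ[1/p], T ⊗ Λ^♯)^∨ …` is a torsion `Λ`-module», proved in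
§17.13 (pp. 279–280) from the Poitou–Tate sequence (17.13.1) (exact up to `×2` at `p = 2`, 14.9 p. 239), the torsion of
`𝐇²` (Thm. 12.4 (1)), the injectivity of the Coleman map (Prop. 17.11) and the non-vanishing of the `p`-adic
`L`-function (Thm. 16.6 (2) + Rohrlich). The tree's packages `Kato2004.MultDivisibilityInputs` (file
`DivisibilityInputsMultiplicative`, dual Selmer datum of key `γ`) and `Kato2004.MultDivisibilityInputsContra` (file
`DivisibilityInputsContragredient`, key `γ⁻¹`, PRINT-EXACT twin) carry exactly these inputs as fields (`upTo_P`, `upTo_X`,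
`isTorsion_H2`, `col_injective`, `pow_mem`, `ιG_eq`); the pure module theory is the tree's
`Kato2004.isTorsion_of_skeleton_upTo` (file `KatoRankBoundAllPrimesSkeletonProofs`). This file records the one-line
consequence as STANDALONE theorems (so far it was only an inline step of
`MultDivisibilityInputs{,Contra}.lengthAt_X_le_at_factor_of_transport` and of `katoDivisibility_*_of_inputs`):

* `MultDivisibilityInputs.isTorsion_X` / `MultDivisibilityInputsContra.isTorsion_X`: a package for a NON-ZERO `L` makes the
  dual Selmer module `D.X = X(E/ℚ_∞)` a torsion `Λ`-module — for ANY prime `p` (`p = 2` included), with NO hypothesis on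
  `𝐇¹` (Thm. 12.4 (2) is not used), on the image of `ρ̄`, or on the vanishing of the local term `𝐇²_loc`.

Motivation (cell `bsd-2adic`, seat `bsd-2adic-k4-w3` GEN 5, crux stmt-BirchSwinnertonDyer-22618; record only): the binder
«`X(W/ℚ_∞)` torsion» of the additive split-twist doors (`…AdditiveKatoTransportQuadraticLayer`, t42 GEN 23) is thereby
discharged from the one typed odd-branch input at `2`. That use is NOT part of this file.

THEOREMS ONLY: no definition, no named fact, no instance, no `sorry`.

References: [Kato2004Asterisque] Thm. 12.4 (1) (p. 221), Thm. 16.2, 16.6 (2) (pp. 269–271), Prop. 17.11 (p. 277), Thm. 17.4 (1)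
(p. 273), §17.13 (17.13.1) (pp. 279–280), 14.9 (p. 239).
-/

noncomputable section

open scoped Classical

namespace Literature.NumberTheory.EllipticCurves.Kato2004

open Module Field Literature.NumberTheory.EllipticCurves.IwasawaAlgebra

variable {W : WeierstrassCurve ℚ} [W.IsElliptic] {p : ℕ} [Fact p.Prime]
  [ContinuousSMul ℤ_[p] (W.tateModule p)] {L : PowerSeries ℚ_[p]} {κ : ZpExtension ℚ p} {γ : absoluteGaloisGroup ℚ}
  {I : IwasawaH1Data W p κ γ}

/-- **Kato's Thm. 17.4 (1) «`X(E/ℚ_∞)` is a torsion `Λ`-module» from a §17.13 package at a multiplicative prime (dual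
Selmer datum of key `γ`), for a non-zero `L`** — any prime `p`, `p = 2` included; no hypothesis on `𝐇¹`, on the image of
`ρ̄_{E,p}`, or on the local term of Thm. 12.5 (3). Proof: `G = pⁿ·L ≠ 0` (`MultDivisibilityInputs.G_ne_zero`), `G = col(loc z)`
for some `z ∈ Z` (`pow_mem`), and the tree's `Kato2004.isTorsion_of_skeleton_upTo` with `c = p^a` (fields `upTo_P`, `upTo_X`,
`col_injective`, `isTorsion_H2`). [cite: Kato2004Asterisque, Thm. 17.4 (1) (p. 273), §17.13 (pp. 279–280), 14.9 (p. 239), Thm. 12.4 (1) (p. 221)] -/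
theorem MultDivisibilityInputs.isTorsion_X {D : W.SelmerDualData κ γ} (K : MultDivisibilityInputs W p L κ γ I D)
    (hL : L ≠ 0) : D.IsTorsion := by
  obtain ⟨hc0, -⟩ := natCast_pow_ne_zero_and_not_mem p K.a
  obtain ⟨z, -, hz⟩ := Submodule.mem_map.mp K.pow_mem
  simp only [LinearMap.coe_comp, Function.comp_apply] at hz
  exact isTorsion_of_skeleton_upTo hc0 K.loc K.toX K.δ K.upTo_P K.upTo_X K.col K.col_injective (K.G_ne_zero hL) hz
    K.isTorsion_H2

/-- **Kato's Thm. 17.4 (1) «`X(E/ℚ_∞)` is a torsion `Λ`-module» from a PRINT-EXACT §17.13 package at a multiplicative prime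
(dual Selmer datum of key `γ⁻¹`), for a non-zero `L`** — any prime `p`, `p = 2` included; no hypothesis on `𝐇¹`, on the
image of `ρ̄_{E,p}`, or on the local term of Thm. 12.5 (3). Same proof as `MultDivisibilityInputs.isTorsion_X`.
[cite: Kato2004Asterisque, Thm. 17.4 (1) (p. 273), §17.13 (pp. 279–280), 14.9 (p. 239), Thm. 12.4 (1) (p. 221)] -/
theorem MultDivisibilityInputsContra.isTorsion_X {D : W.SelmerDualData κ γ⁻¹}
    (K : MultDivisibilityInputsContra W p L κ γ I D) (hL : L ≠ 0) : D.IsTorsion := by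
  obtain ⟨hc0, -⟩ := natCast_pow_ne_zero_and_not_mem p K.a
  have hG : K.G ≠ 0 := by
    intro hG0
    have hpn : PowerSeries.C ((p : ℚ_[p]) ^ K.n) ≠ 0 := by
      rw [Ne, map_eq_zero_iff _ (PowerSeries.C_injective), pow_eq_zero_iff']
      exact fun h => (Nat.cast_ne_zero.mpr (Fact.out : p.Prime).ne_zero) h.1
    have h := K.ιG_eq
    rw [hG0, map_zero, eq_comm, mul_eq_zero] at h
    exact h.elim hpn hL
  obtain ⟨z, -, hz⟩ := Submodule.mem_map.mp K.pow_mem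
  simp only [LinearMap.coe_comp, Function.comp_apply] at hz
  exact isTorsion_of_skeleton_upTo hc0 K.loc K.toX K.δ K.upTo_P K.upTo_X K.col K.col_injective hG hz K.isTorsion_H2

/-- **Package for `L = ι(π)·L₀` with an integral multiple `L̃₀ ≠ 0` of `L₀` (`ι L̃₀ = p^m·L₀`) ⟹ `X` torsion** — the binder
shape of the tree's doors (`MultDivisibilityInputsContra.lengthAt_X_le_off_factor`): `L̃₀ ≠ 0` and `π ≠ 0` give `L ≠ 0`.
[cite: Kato2004Asterisque, Thm. 17.4 (1) (p. 273), Thm. 16.2 (p. 269)] -/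
theorem MultDivisibilityInputsContra.isTorsion_X_of_doorMultiple {D : W.SelmerDualData κ γ⁻¹} {π : IwasawaAlgebra p}
    {L₀ : PowerSeries ℚ_[p]} (K : MultDivisibilityInputsContra W p (iwasawaToPowerSeries p π * L₀) κ γ I D) (hπ : π ≠ 0)
    {Lt : IwasawaAlgebra p} {m : ℕ} (hLt : iwasawaToPowerSeries p Lt = PowerSeries.C ((p : ℚ_[p]) ^ m) * L₀)
    (hLt0 : Lt ≠ 0) : D.IsTorsion := by
  refine K.isTorsion_X (mul_ne_zero (fun h => hπ (iwasawaToPowerSeries_injective p (by rw [h, map_zero]))) ?_)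
  intro h0
  apply hLt0
  apply iwasawaToPowerSeries_injective p
  rw [hLt, h0, mul_zero, map_zero]

/-- Key-`γ` twin of `MultDivisibilityInputsContra.isTorsion_X_of_doorMultiple`.
[cite: Kato2004Asterisque, Thm. 17.4 (1) (p. 273), Thm. 16.2 (p. 269)] -/
theorem MultDivisibilityInputs.isTorsion_X_of_doorMultiple {D : W.SelmerDualData κ γ} {π : IwasawaAlgebra p}
    {L₀ : PowerSeries ℚ_[p]} (K : MultDivisibilityInputs W p (iwasawaToPowerSeries p π * L₀) κ γ I D) (hπ : π ≠ 0)
    {Lt : IwasawaAlgebra p} {m : ℕ} (hLt : iwasawaToPowerSeries p Lt = PowerSeries.C ((p : ℚ_[p]) ^ m) * L₀)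
    (hLt0 : Lt ≠ 0) : D.IsTorsion := by
  refine K.isTorsion_X (mul_ne_zero (fun h => hπ (iwasawaToPowerSeries_injective p (by rw [h, map_zero]))) ?_)
  intro h0
  apply hLt0
  apply iwasawaToPowerSeries_injective p
  rw [hLt, h0, mul_zero, map_zero]

end Literature.NumberTheory.EllipticCurves.Kato2004

end
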